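import Literature.Probability.Moments.BrascampLiebVariance
import Literature.Probability.Distributions.BrascampLieb
import HarnessLib

/-!
# Brascamp–Lieb variance inequality, uniformly convex case — reduction to Theorem 4.1

`Literature/Probability/Moments`. The named fact
`Literature.Probability.Moments.BrascampLieb1976_thm41_uniform` (file `BrascampLiebVariance`) is
the *uniformly convex special case* of Brascamp–Lieb 1976, Theorem 4.1, exactly as its docstring
says: "Thm 4.1 with `V'' ≥ λ·1`, hence `(V'')⁻¹ ≤ λ⁻¹·1`". The printed Theorem 4.1 itself (general
strictly convex `f ∈ C²`, bound `var h ≤ ⟨(h_x, (f_xx)⁻¹ h_x)⟩`) is vendored as the named fact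
`Literature.Probability.Distributions.BrascampLieb1976_thm41` (file
`Literature/Probability/Distributions/BrascampLieb`). This file proves the implication

  `BrascampLieb1976_thm41 → BrascampLieb1976_thm41_uniform`

(`BrascampLieb1976_thm41_uniform_of_thm41`), i.e. the corollary step of the paper
(H. J. Brascamp, E. H. Lieb, J. Funct. Anal. **22** (1976) 366–389, Thm 4.1, pp. 375–376, and
eq. (4.7)/(4.12)-style specialisation `f_xx ≥ λ·1 ⇒ (f_xx)⁻¹ ≤ λ⁻¹·1`). The ingredients, all
proved here:

* transfer between `EuclideanSpace ℝ (Fin n)` (the typing of the uniform fact) and `Fin n → ℝ`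
  (the typing of the general fact) along the volume-preserving `WithLp.toLp 2`;
* for `F ∈ C²` the first-order uniform convexity `F y ≥ F x + DF(x)(y-x) + (λ/2)|y-x|²` gives
  `D²F(x)(w,w) ≥ λ|w|²` (`le_fderiv_fderiv_of_uniformConvex`), hence the coordinate Hessian is
  symmetric positive definite and `vᵀ(f_xx)⁻¹v ≤ λ⁻¹|v|²`
  (`dotProduct_inv_mulVec_le_of_le_quadForm`);
* a `λ`-uniformly convex continuous function attains its minimum (coercivity);
* bookkeeping between `evariance`/`logConcaveMeasure` (normalised, `ℝ≥0∞`-valued) and the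
  explicit weighted Bochner integrals of the uniform statement.

No new definitions, no new named facts. Discharging `BrascampLieb1976_thm41_uniform` outright
(`…_holds`) needs the full Theorem 4.1 (`BrascampLieb1976_thm41_holds`), whose printed proof
(pp. 377–379: one-dimensional integration by parts, induction on the dimension through Theorem 4.2,
modification of `F` outside the support of `h`, two limiting procedures) is not yet formalised.
-/

noncomputable section

open MeasureTheory ProbabilityTheory Filter Set WithLp
open scoped ENNReal NNReal Topology Matrix RealInnerProductSpace

namespace Literature.Probability.Moments

open Literature.Probability.Distributions

variable {n : ℕ}

/-! ## Linear algebra: `H ≥ λ·1 ⇒ vᵀH⁻¹v ≤ λ⁻¹|v|²` -/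

/-- If an invertible real matrix `M` satisfies `wᵀMw ≥ λ|w|²` for all `w` (`λ > 0`), then
`vᵀM⁻¹v ≤ λ⁻¹|v|²` for all `v` (no symmetry needed: with `u = M⁻¹v`, `vᵀu = uᵀMu ≥ λ|u|²` and
`2λ vᵀu ≤ |v|² + λ²|u|²`). [folklore] -/
theorem dotProduct_inv_mulVec_le_of_le_quadForm {ι : Type*} [Fintype ι] [DecidableEq ι]
    {M : Matrix ι ι ℝ} (hM : IsUnit M.det) {lam : ℝ} (hlam : 0 < lam)
    (hq : ∀ w : ι → ℝ, lam * (w ⬝ᵥ w) ≤ w ⬝ᵥ (M *ᵥ w)) (v : ι → ℝ) :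
    v ⬝ᵥ (M⁻¹ *ᵥ v) ≤ lam⁻¹ * (v ⬝ᵥ v) := by
  set u : ι → ℝ := M⁻¹ *ᵥ v with hu
  have hMu : M *ᵥ u = v := by
    rw [hu, Matrix.mulVec_mulVec, Matrix.mul_nonsing_inv _ hM, Matrix.one_mulVec]
  have h1 : lam * (u ⬝ᵥ u) ≤ v ⬝ᵥ u := by
    have h := hq u
    rwa [hMu, dotProduct_comm u v] at h
  have h2 : 0 ≤ v ⬝ᵥ v - 2 * lam * (v ⬝ᵥ u) + lam ^ 2 * (u ⬝ᵥ u) := by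
    have h0 : 0 ≤ (v - lam • u) ⬝ᵥ (v - lam • u) :=
      Finset.sum_nonneg fun i _ => mul_self_nonneg _
    have e : (v - lam • u) ⬝ᵥ (v - lam • u) =
        v ⬝ᵥ v - 2 * lam * (v ⬝ᵥ u) + lam ^ 2 * (u ⬝ᵥ u) := by
      simp only [sub_dotProduct, dotProduct_sub, dotProduct_smul, smul_dotProduct, smul_eq_mul,
        dotProduct_comm u v]
      ring
    rwa [e] at h0
  have h3 : lam ^ 2 * (u ⬝ᵥ u) ≤ lam * (v ⬝ᵥ u) := by
    have := mul_le_mul_of_nonneg_left h1 hlam.le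
    calc lam ^ 2 * (u ⬝ᵥ u) = lam * (lam * (u ⬝ᵥ u)) := by ring
      _ ≤ lam * (v ⬝ᵥ u) := this
  rw [le_inv_mul_iff₀ hlam]
  linarith

/-! ## Calculus on `Fin n → ℝ`: entries of the coordinate Hessian, uniform convexity -/

/-- The entries of the coordinate Hessian of a function whose derivative is differentiable are
the values of the second Fréchet derivative on the standard basis:
`(f_xx)ᵢⱼ = D²f(x)(eᵢ)(eⱼ)`. [folklore] -/
theorem coordHessian_apply_eq {F : (Fin n → ℝ) → ℝ} {x : Fin n → ℝ}
    (hF : DifferentiableAt ℝ (fderiv ℝ F) x) (i j : Fin n) :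
    coordHessian F x i j = fderiv ℝ (fderiv ℝ F) x (Pi.single i 1) (Pi.single j 1) := by
  unfold coordHessian
  rw [Matrix.of_apply,
    fderiv_clm_apply (c := fderiv ℝ F) (u := fun _ => (Pi.single j (1 : ℝ) : Fin n → ℝ)) hF
      (differentiableAt_const _)]
  simp

/-- A continuous bilinear form on `ι → ℝ` evaluated on the diagonal, in coordinates:
`B(v)(w) = ∑ᵢ vᵢ ∑ⱼ B(eᵢ)(eⱼ) wⱼ`. [folklore] -/
theorem bilin_apply_eq_sum_single {ι : Type*} [Fintype ι] [DecidableEq ι]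
    (B : (ι → ℝ) →L[ℝ] (ι → ℝ) →L[ℝ] ℝ) (v w : ι → ℝ) :
    B v w = ∑ i, v i * ∑ j, B (Pi.single i 1) (Pi.single j 1) * w j := by
  have hv : v = ∑ i, v i • (Pi.single i (1 : ℝ) : ι → ℝ) := by
    ext k; simp [Finset.sum_apply, Pi.single_apply]
  have hw : w = ∑ j, w j • (Pi.single j (1 : ℝ) : ι → ℝ) := by
    ext k; simp [Finset.sum_apply, Pi.single_apply]
  have step1 : B v w = ∑ i, v i * B (Pi.single i 1) w := by
    conv_lhs => rw [hv]
    simp only [map_sum, map_smul, FunLike.coe_sum, FunLike.coe_smul, Finset.sum_apply,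
      Pi.smul_apply, smul_eq_mul]
  have step2 : ∀ i, B (Pi.single i 1) w = ∑ j, B (Pi.single i 1) (Pi.single j 1) * w j := by
    intro i
    conv_lhs => rw [hw]
    simp only [map_sum, map_smul, smul_eq_mul]
    exact Finset.sum_congr rfl fun j _ => mul_comm _ _
  rw [step1]
  exact Finset.sum_congr rfl fun i _ => by rw [step2]

/-- **Second-order form of uniform convexity.** If `F ∈ C²(ℝⁿ)` satisfies the first-order
`λ`-convexity inequality `F y ≥ F x + DF(x)(y - x) + (λ/2)|y - x|²` for all `x, y`, then
`D²F(x)(w, w) ≥ λ|w|²` (add the inequality for `(x, x+tw)` and `(x+tw, x)` to get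
`(DF(x+tw) - DF(x))(w) ≥ λ t |w|²`, divide by `t > 0` and let `t → 0`). [folklore] -/
theorem le_fderiv_fderiv_of_uniformConvex {F : (Fin n → ℝ) → ℝ} (hF : ContDiff ℝ 2 F)
    {lam : ℝ}
    (hconv : ∀ x y, F x + fderiv ℝ F x (y - x) + lam / 2 * ((y - x) ⬝ᵥ (y - x)) ≤ F y)
    (x w : Fin n → ℝ) : lam * (w ⬝ᵥ w) ≤ fderiv ℝ (fderiv ℝ F) x w w := by
  set φ : ℝ → ℝ := fun t => fderiv ℝ F (x + t • w) w with hφ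
  have hdiff : Differentiable ℝ (fderiv ℝ F) :=
    (hF.fderiv_right (m := 1) (by norm_num)).differentiable (by norm_num)
  -- the derivative of `φ` at `0` is `D²F(x)(w)(w)`
  have hderiv : HasDerivAt φ (fderiv ℝ (fderiv ℝ F) x w w) 0 := by
    have hl : HasDerivAt (fun t : ℝ => x + t • w) w 0 := by
      simpa using ((hasDerivAt_id (0 : ℝ)).smul_const w).const_add x
    have hG : HasFDerivAt (fderiv ℝ F) (fderiv ℝ (fderiv ℝ F) x) (x + (0 : ℝ) • w) := by
      rw [zero_smul, add_zero]; exact (hdiff x).hasFDerivAt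
    have hG' : HasDerivAt (fun t : ℝ => fderiv ℝ F (x + t • w)) (fderiv ℝ (fderiv ℝ F) x w) 0 :=
      hG.comp_hasDerivAt (0 : ℝ) hl
    have happ : HasDerivAt (fun t : ℝ => fderiv ℝ F (x + t • w) w)
        (fderiv ℝ (fderiv ℝ F) x w w) 0 := by
      have := hG'.clm_apply (hasDerivAt_const (0 : ℝ) w)
      simpa using this
    exact happ
  -- slope bound for `t > 0`
  have hslope : ∀ t : ℝ, 0 < t → lam * (w ⬝ᵥ w) ≤ t⁻¹ • (φ (0 + t) - φ 0) := by
    intro t ht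
    have h1 := hconv x (x + t • w)
    have h2 := hconv (x + t • w) x
    rw [add_sub_cancel_left] at h1
    rw [sub_add_cancel_left] at h2
    simp only [map_smul, map_neg, smul_eq_mul, neg_dotProduct_neg, dotProduct_smul,
      smul_dotProduct] at h1 h2
    have φ0 : φ 0 = fderiv ℝ F x w := by simp [hφ]
    have φt : φ (0 + t) = fderiv ℝ F (x + t • w) w := by simp [hφ]
    rw [φ0, φt, smul_eq_mul, le_inv_mul_iff₀ ht]
    -- `t·(λ t |w|² - (DF(x+tw)w - DF(x)w)) ≤ 0`
    have hsum : t * (lam * t * (w ⬝ᵥ w) - (fderiv ℝ F (x + t • w) w - fderiv ℝ F x w)) ≤ 0 := by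
      linarith
    have hdiv : lam * t * (w ⬝ᵥ w) - (fderiv ℝ F (x + t • w) w - fderiv ℝ F x w) ≤ 0 := by
      have := mul_nonpos_of_nonneg_of_nonpos (inv_nonneg.mpr ht.le) hsum
      rwa [← mul_assoc, inv_mul_cancel₀ ht.ne', one_mul] at this
    linarith
  -- pass to the limit `t → 0⁺`
  exact ge_of_tendsto hderiv.tendsto_slope_zero_right
    (eventually_nhdsWithin_of_forall fun t ht => hslope t ht)

/-! ## The reduction -/

/-- **Brascamp–Lieb 1976, Theorem 4.1 ⇒ its uniformly convex case.** The printed variance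
inequality `var h ≤ ⟨(h_x, (f_xx)⁻¹ h_x)⟩` for strictly convex `f ∈ C²` with a minimum
(`Literature.Probability.Distributions.BrascampLieb1976_thm41`) implies the vendored special case
`Literature.Probability.Moments.BrascampLieb1976_thm41_uniform`: for `λ`-uniformly convex `V`
(first-order form) one has `V'' ≥ λ·1`, hence `V''` is positive definite, `V` attains its minimum,
and `(V'')⁻¹ ≤ λ⁻¹·1`, so `∫ |f - ⟨f⟩|² e^{-V} ≤ λ⁻¹ ∫ ‖∇f‖² e^{-V}`.
[cite: BrascampLieb1976, Thm 4.1] -/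
theorem BrascampLieb1976_thm41_uniform_of_thm41 (hBL : BrascampLieb1976_thm41) :
    BrascampLieb1976_thm41_uniform := by
  intro n V f lam hlam hV hf hconv hZint hfint hf2int hgint
  show (∫ x, (f x - (∫ x, f x * Real.exp (-V x)) / ∫ x, Real.exp (-V x)) ^ 2 *
      Real.exp (-V x)) ≤ lam⁻¹ * ∫ x, ‖gradient f x‖ ^ 2 * Real.exp (-V x)
  -- ### transfer to `Fin n → ℝ`
  set A : (Fin n → ℝ) ≃L[ℝ] EuclideanSpace ℝ (Fin n) := (EuclideanSpace.equiv (Fin n) ℝ).symm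
    with hA
  set F : (Fin n → ℝ) → ℝ := fun x => V (toLp 2 x) with hFdef
  set H : (Fin n → ℝ) → ℝ := fun x => f (toLp 2 x) with hHdef
  have hFcomp : F = V ∘ A := rfl
  have hHcomp : H = f ∘ A := rfl
  have hF2 : ContDiff ℝ 2 F := hFcomp ▸ hV.comp A.contDiff
  have hH1 : ContDiff ℝ 1 H := hHcomp ▸ hf.comp A.contDiff
  have hFderiv : ∀ x u, fderiv ℝ F x u = fderiv ℝ V (toLp 2 x) (toLp 2 u) := by
    intro x u
    rw [hFcomp, A.comp_right_fderiv]
    rfl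
  have hHderiv : ∀ x u, fderiv ℝ H x u = fderiv ℝ f (toLp 2 x) (toLp 2 u) := by
    intro x u
    rw [hHcomp, A.comp_right_fderiv]
    rfl
  have hnormsq : ∀ u : Fin n → ℝ, ‖toLp 2 u‖ ^ 2 = u ⬝ᵥ u := by
    intro u
    rw [EuclideanSpace.real_norm_sq_eq]
    simp [dotProduct, pow_two]
  -- first-order uniform convexity in coordinates
  have hconvF : ∀ x y : Fin n → ℝ,
      F x + fderiv ℝ F x (y - x) + lam / 2 * ((y - x) ⬝ᵥ (y - x)) ≤ F y := by
    intro x y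
    have h := hconv (toLp 2 x) (toLp 2 y)
    rw [inner_gradient_left, ← WithLp.toLp_sub, hnormsq, ← hFderiv] at h
    exact h
  -- ### the coordinate Hessian of `F` is symmetric and `≥ λ·1`
  have hdiffF' : Differentiable ℝ (fderiv ℝ F) :=
    (hF2.fderiv_right (m := 1) (by norm_num)).differentiable (by norm_num)
  have hHess : ∀ x i j,
      coordHessian F x i j = fderiv ℝ (fderiv ℝ F) x (Pi.single i 1) (Pi.single j 1) :=
    fun x i j => coordHessian_apply_eq (hdiffF' x) i j
  have hquad : ∀ x w, w ⬝ᵥ (coordHessian F x *ᵥ w) = fderiv ℝ (fderiv ℝ F) x w w := by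
    intro x w
    rw [bilin_apply_eq_sum_single (fderiv ℝ (fderiv ℝ F) x) w w]
    simp only [dotProduct, Matrix.mulVec, hHess]
  have hlow : ∀ x w, lam * (w ⬝ᵥ w) ≤ w ⬝ᵥ (coordHessian F x *ᵥ w) := fun x w => by
    rw [hquad]
    exact le_fderiv_fderiv_of_uniformConvex hF2 hconvF x w
  have hposdef : ∀ x, (coordHessian F x).PosDef := by
    intro x
    refine Matrix.PosDef.of_dotProduct_mulVec_pos ?_ fun w hw => ?_
    · refine Matrix.IsHermitian.ext fun i j => ?_
      rw [star_trivial, hHess, hHess]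
      exact hF2.contDiffAt.isSymmSndFDerivAt (by simp) _ _
    · rw [star_trivial]
      have hwpos : 0 < w ⬝ᵥ w := by
        have := Matrix.dotProduct_star_self_pos_iff.mpr hw
        rwa [star_trivial] at this
      exact lt_of_lt_of_le (mul_pos hlam hwpos) (hlow x w)
  -- ### `F` attains its minimum (coercivity of a uniformly convex function)
  have hmin : ∃ x₀, ∀ x, F x₀ ≤ F x := by
    obtain ⟨z₀, hz₀⟩ : ∃ z₀, ∀ z, V z₀ ≤ V z := by
      refine hV.continuous.exists_forall_le' 0 ?_
      have hev := (tendsto_norm_cocompact_atTop (E := EuclideanSpace ℝ (Fin n))).eventually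
        (eventually_ge_atTop (2 * ‖gradient V 0‖ / lam))
      refine hev.mono fun z hz => ?_
      have h := hconv 0 z
      simp only [sub_zero] at h
      have hcs : -(‖gradient V 0‖ * ‖z‖) ≤ ⟪gradient V 0, z⟫ :=
        neg_le_of_abs_le (abs_real_inner_le_norm _ _)
      have hz' : ‖gradient V 0‖ ≤ lam / 2 * ‖z‖ := by
        rw [div_le_iff₀ hlam] at hz
        linarith
      have h1 : ‖gradient V 0‖ * ‖z‖ ≤ lam / 2 * ‖z‖ ^ 2 := by
        calc ‖gradient V 0‖ * ‖z‖ ≤ lam / 2 * ‖z‖ * ‖z‖ :=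
              mul_le_mul_of_nonneg_right hz' (norm_nonneg _)
          _ = lam / 2 * ‖z‖ ^ 2 := by ring
      linarith
    exact ⟨ofLp z₀, fun x => by simpa [hFdef] using hz₀ (toLp 2 x)⟩
  -- ### apply Theorem 4.1
  obtain ⟨-, hmain⟩ := hBL n F hF2 hposdef hmin
  -- ### measure-theoretic bookkeeping
  have hmp : MeasurePreserving (toLp 2 : (Fin n → ℝ) → EuclideanSpace ℝ (Fin n)) :=
    PiLp.volume_preserving_toLp (Fin n)
  have hme : MeasurableEmbedding (toLp 2 : (Fin n → ℝ) → EuclideanSpace ℝ (Fin n)) :=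
    (MeasurableEquiv.toLp 2 (Fin n → ℝ)).measurableEmbedding
  have hint_iff : ∀ g : EuclideanSpace ℝ (Fin n) → ℝ,
      Integrable (fun x => g (toLp 2 x)) ↔ Integrable g :=
    fun g => hmp.integrable_comp_emb hme
  have hint_eq : ∀ g : EuclideanSpace ℝ (Fin n) → ℝ, ∫ x, g (toLp 2 x) = ∫ z, g z :=
    fun g => hmp.integral_comp hme g
  have iZ : Integrable (fun x => Real.exp (-F x)) :=
    (hint_iff fun z => Real.exp (-V z)).2 hZint
  have if1 : Integrable (fun x => H x * Real.exp (-F x)) :=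
    (hint_iff fun z => f z * Real.exp (-V z)).2 hfint
  have if2 : Integrable (fun x => H x ^ 2 * Real.exp (-F x)) :=
    (hint_iff fun z => f z ^ 2 * Real.exp (-V z)).2 hf2int
  have ig : Integrable (fun x => ‖gradient f (toLp 2 x)‖ ^ 2 * Real.exp (-F x)) :=
    (hint_iff fun z => ‖gradient f z‖ ^ 2 * Real.exp (-V z)).2 hgint
  set Z : ℝ := ∫ z, Real.exp (-V z) with hZdef
  have hZF : ∫ x, Real.exp (-F x) = Z := hint_eq fun z => Real.exp (-V z)
  have hZpos : 0 < Z := by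
    rw [hZdef, integral_pos_iff_support_of_nonneg (fun z => (Real.exp_pos _).le) hZint]
    have hsupp : Function.support (fun z : EuclideanSpace ℝ (Fin n) => Real.exp (-V z)) = univ := by
      ext z
      simp [(Real.exp_pos _).ne']
    rw [hsupp]
    exact isOpen_univ.measure_pos volume univ_nonempty
  set ρ : (Fin n → ℝ) → ℝ≥0∞ := fun x => ENNReal.ofReal (Real.exp (-F x)) with hρ
  have hFcont : Continuous F := hF2.continuous
  have hρmeas : Measurable ρ := by
    rw [hρ]
    fun_prop
  have hρlt : ∀ x, ρ x < ∞ := fun x => ENNReal.ofReal_lt_top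
  have hZρ : ∫⁻ x, ρ x = ENNReal.ofReal Z := by
    rw [← hZF, ofReal_integral_eq_lintegral_ofReal iZ (ae_of_all _ fun x => (Real.exp_pos _).le)]
  have hZρ0 : (∫⁻ x, ρ x) ≠ 0 := by
    rw [hZρ]
    exact (ENNReal.ofReal_pos.mpr hZpos).ne'
  have hc_ne_top : (∫⁻ x, ρ x)⁻¹ ≠ ∞ := ENNReal.inv_ne_top.mpr hZρ0
  have hc_toReal : ((∫⁻ x, ρ x)⁻¹).toReal = Z⁻¹ := by
    rw [ENNReal.toReal_inv, hZρ, ENNReal.toReal_ofReal hZpos.le]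
  have hμ : logConcaveMeasure F = (∫⁻ x, ρ x)⁻¹ • volume.withDensity ρ := rfl
  have hρreal : ∀ x, (ρ x).toReal = Real.exp (-F x) := fun x =>
    ENNReal.toReal_ofReal (Real.exp_pos _).le
  -- integrals and integrability with respect to the normalised log-concave measure
  have hμint : ∀ g : (Fin n → ℝ) → ℝ,
      ∫ x, g x ∂(logConcaveMeasure F) = Z⁻¹ * ∫ x, g x * Real.exp (-F x) := by
    intro g
    rw [hμ, integral_smul_measure, integral_withDensity_eq_integral_toReal_smul hρmeas
      (ae_of_all _ hρlt), hc_toReal, smul_eq_mul]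
    congr 1
    refine integral_congr_ae (ae_of_all _ fun x => ?_)
    simp only [hρreal, smul_eq_mul, mul_comm]
  have hμintble : ∀ g : (Fin n → ℝ) → ℝ,
      Integrable (fun x => g x * Real.exp (-F x)) → Integrable g (logConcaveMeasure F) := by
    intro g hg
    rw [hμ]
    refine Integrable.smul_measure ?_ hc_ne_top
    rw [integrable_withDensity_iff_integrable_smul' hρmeas (ae_of_all _ hρlt)]
    refine hg.congr (ae_of_all _ fun x => ?_)
    simp only [hρreal, smul_eq_mul, mul_comm]
  have hHmem : MemLp H 2 (logConcaveMeasure F) := by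
    rw [memLp_two_iff_integrable_sq hH1.continuous.aestronglyMeasurable]
    exact hμintble _ if2
  -- ### the inequality of Theorem 4.1 for `H`
  have key := hmain H hH1 hHmem
  -- the mean
  have hmean : ∫ x, H x ∂(logConcaveMeasure F) = (∫ z, f z * Real.exp (-V z)) / Z := by
    rw [hμint, inv_mul_eq_div]
    exact congrArg (fun r => r / Z) (hint_eq fun z => f z * Real.exp (-V z))
  set mH : ℝ := (∫ z, f z * Real.exp (-V z)) / Z with hmH
  -- the left-hand side: `evariance = ofReal (∫ (H - mH)² dμ)`
  have ivar : Integrable (fun x => (H x - mH) ^ 2 * Real.exp (-F x)) := by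
    have e : (fun x => (H x - mH) ^ 2 * Real.exp (-F x)) = fun x =>
        H x ^ 2 * Real.exp (-F x) - 2 * mH * (H x * Real.exp (-F x)) +
          mH ^ 2 * Real.exp (-F x) := by
      funext x; ring
    rw [e]
    exact (if2.sub (if1.const_mul _)).add (iZ.const_mul _)
  have hev : evariance H (logConcaveMeasure F) =
      ENNReal.ofReal (∫ x, (H x - mH) ^ 2 ∂(logConcaveMeasure F)) := by
    rw [evariance_eq_lintegral_ofReal, hmean, ← ofReal_integral_eq_lintegral_ofReal
      (hμintble _ ivar) (ae_of_all _ fun x => sq_nonneg _)]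
  -- the right-hand side: `(f_xx)⁻¹ ≤ λ⁻¹·1` pointwise
  have hG : ∀ x, coordGradient H x ⬝ᵥ coordGradient H x = ‖gradient f (toLp 2 x)‖ ^ 2 := by
    intro x
    have hgi : ∀ i, coordGradient H x i = gradient f (toLp 2 x) i := by
      intro i
      show fderiv ℝ H x (Pi.single i 1) = gradient f (toLp 2 x) i
      rw [hHderiv, PiLp.toLp_single, ← inner_gradient_left,
        EuclideanSpace.inner_single_right]
      simp
    rw [EuclideanSpace.real_norm_sq_eq]
    simp only [dotProduct, hgi, pow_two]
  have hpt : ∀ x, coordGradient H x ⬝ᵥ ((coordHessian F x)⁻¹ *ᵥ coordGradient H x) ≤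
      lam⁻¹ * ‖gradient f (toLp 2 x)‖ ^ 2 := by
    intro x
    rw [← hG]
    exact dotProduct_inv_mulVec_le_of_le_quadForm
      ((Matrix.isUnit_iff_isUnit_det _).mp (hposdef x).isUnit) hlam (hlow x) _
  have hR : ∫⁻ x, ENNReal.ofReal
        (coordGradient H x ⬝ᵥ ((coordHessian F x)⁻¹ *ᵥ coordGradient H x)) ∂(logConcaveMeasure F)
      ≤ ENNReal.ofReal (∫ x, lam⁻¹ * ‖gradient f (toLp 2 x)‖ ^ 2 ∂(logConcaveMeasure F)) := by
    rw [ofReal_integral_eq_lintegral_ofReal ((hμintble _ ig).const_mul _)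
      (ae_of_all _ fun x => by positivity)]
    exact lintegral_mono fun x => ENNReal.ofReal_le_ofReal (hpt x)
  -- ### combine and unfold
  have hfinal := (hev ▸ key).trans hR
  rw [ENNReal.ofReal_le_ofReal_iff (integral_nonneg fun x => by positivity), hμint, hμint]
    at hfinal
  have hfinal' : ∫ x, (H x - mH) ^ 2 * Real.exp (-F x) ≤
      ∫ x, lam⁻¹ * ‖gradient f (toLp 2 x)‖ ^ 2 * Real.exp (-F x) :=
    le_of_mul_le_mul_left hfinal (inv_pos.mpr hZpos)
  have hL : ∫ x, (H x - mH) ^ 2 * Real.exp (-F x) = ∫ z, (f z - mH) ^ 2 * Real.exp (-V z) :=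
    hint_eq fun z => (f z - mH) ^ 2 * Real.exp (-V z)
  have hRt : ∫ x, lam⁻¹ * ‖gradient f (toLp 2 x)‖ ^ 2 * Real.exp (-F x) =
      lam⁻¹ * ∫ z, ‖gradient f z‖ ^ 2 * Real.exp (-V z) := by
    rw [← hint_eq fun z => ‖gradient f z‖ ^ 2 * Real.exp (-V z), ← integral_const_mul]
    refine integral_congr_ae (ae_of_all _ fun x => ?_)
    simp only [mul_assoc, hFdef]
  rw [hL, hRt] at hfinal'
  simpa [hmH, hZdef] using hfinal'

end Literature.Probability.Moments

end
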